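import Literature.MathematicalPhysics.QuantumFieldTheory.Balaban1983to89.B5G183FreeDecay

/-!
# T⁴ programme, spine node NE2 (U1a), sub-row Δ3 «NE2-WALK» — U = 1 supplier: THE PERIOD-AWARE IMAGE SUM, i.e. the
# n-UNIFORM exponential decay of the free fine-lattice kernel ON THE TORUS — an INDEPENDENT RE-DERIVATION of
# `Literature/…/B5G183FreeUniform` (pv15-g12, 2026-08-19), which is the PRIOR module that closed `B5G183FreeDecay` HONEST SCOPE (v)

NE2 formalisation swarm `b2b-balaban-t4-ne2-formalise-*`, leaf prover 06 (gen 2), INTENT CLAIMS.log 2026-08-20 (sub-row `T4-U1a.S-NE2-D3-WALK°`,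
the U = 1 torus-decay item flagged by the row owner t4-ne2-p1-g11).

v1.1 (DOCSTRING-ONLY; every declaration byte-identical to v1 p219324).  PRIOR ART IN THE TREE, MISSED BY v1's HEADER (erratum, journal
2026-08-20 ≈13:46Z): `Literature/MathematicalPhysics/QuantumFieldTheory/Balaban1983to89/B5G183FreeUniform.lean` (unit b2b-balaban-pv15-g12, p192381,
ACCEPTED 2026-08-19) ALREADY proves the period-aware image sum — `abs_add_mul_ge_large` (`|y + Pj| ≥ |y| + P(|j| − 1)`),
`summable_geometric_int_shift` (`Σ_j r^{(|j|−1)} = 1 + 2/(1 − r)`), `periodise_bound_large` (constant `(1 + 2/(1 − e^{−ρ}))^{d+1}` for any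
`0 < ρ ≤ (κ/(d+1))·P_i`), the torus-metric twins, and the n-UNIFORM free-kernel END `B5G183FreeUniform.torusKernel_freeMult_decay_uniform`
(constant `MF N·(1 + 2/(1 − e^{−rOf(d+1)/(d+1)}))^{d+1}`, a function of `d, N` only) — and it is THAT module which closed `B5G183FreeDecay`
HONEST SCOPE (v) (and `B5G183KernelDecay` HONEST SCOPE (iii)); it also carries §6 block-point bounds this file does not have.  THIS FILE is
therefore a REDUNDANT independent re-derivation; its only additions are cosmetic/marginal: the per-coordinate EXACT image-sum constant
`periodConstU κ d N = Π_i (1 + 2(1 − e^{−(κ/(d+1))·N_i})⁻¹)` (the two-sided sum itself, rather than a uniform `ρ`), the scaling identity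
`periodConstU_div`, `periodConstU_le_periodConst`.  Consumers should cite `B5G183FreeUniform` as the module of record.

THE POINT (as in `B5G183FreeUniform`): `B4TorusKernel.exp_translate_le` uses only `N ≥ 1` (`|y + Nj| ≥ |y| + |j| − 1`), so the torus
constant `periodConst κ d ~ (2n/r)^{d+1}` of `B5G183FreeDecay.torusKernel_freeMult_decay` is not `n`-uniform; for a centred `2|y| ≤ N`,
`j ≠ 0`, one has `|y + Nj| ≥ |y| + N(|j| − 1)`, whence `Σ_j e^{−κ|y + Nj|} ≤ e^{−κ|y|}(1 + 2/(1 − e^{−κN}))`, `n`-free at `κ = r/n`, `N = nL`.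

CONTENTS ([folklore]; classical Poisson-summation bookkeeping; OURS):
 * §1 `abs_add_mul_ge_period`, `imageWeight κ N j` (`1` at `j = 0`, else `(e^{−κN})^{|j|−1}`), `exp_translate_le_period`, `tsum_imageWeight`;
 * §2 `periodConstU κ d N = Π_i (1 + 2(1 − e^{−(κ/(d+1))N_i})⁻¹)` (`≤ periodConst κ d`: `periodConstU_le_periodConst`) and the `MultiPeriod`
   twins `norm_translate_le_period`, `periodise_bound_period`, `periodise_bound_supNorm_period`;
 * §3 the torus-kernel twins `torusKernel_decay_period`, `…_descend_decay_period`, `…_decay_torusMetric_period`, `…_descend_decay_torusMetric_period`;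
 * §4 THE FREE KERNEL: `torusKernel_freeMult_decay_period` (any period vector) and **`torusKernel_freeMult_decay_uniform`** (fine torus
   `P_i = n·L_i`): `‖torusKernel (descendC freeMult …) P m‖ ≤ MF N · periodConstU (r(d+1)) d L · e^{−(r(d+1)/(n(d+1)))·torusSupNorm P m}` —
   constant and rate PER COARSE UNIT (`torusSupNorm P m / n`)
   are free of `n` (the statement `B5G183FreeUniform.torusKernel_freeMult_decay_uniform` proved first, 2026-08-19; re-derived here with the
   per-coordinate constant).

WHAT THIS IS NOT.  Not the dictionary from kernel decay to the entries of the unit-lattice images `calGlev`/`avgTow` (GAPS G-ne2p2-9 (β)):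
`Spine/NE2BalabanDecayRate`'s binder `hdec` is NOT discharged here.  Nothing of Bałaban's carriers (B0) or node NE3; `U = 1`, free part only.

HONEST FRAMING (T4-DAG p. 1).  Classical; statements OURS; constants crude; REDUNDANT with `B5G183FreeUniform` (see above); NE2 (U1a) NOT
proved; spine PROVED 0/9; NOT infinite volume / mass gap / Clay / summit progress.  HONEST DEPENDENCY: continuum YM on T⁴ ⇐ BetaPertH ∧ nine
spine estimates (0/9 proved); BetaPertH ⇐ (D1) ∧ (D4) ∧ CAP+tail; G-an2-4 gates asym, D1 and NE2/3/4.  ABSOLUTE RULE kept; no `def … : Prop` fact; no `sorry`.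
-/

noncomputable section

open scoped BigOperators Real
open Finset Complex

namespace Summit.QuantumFields.BalabanUV.T4Continuum.TorusKernelUniformDecay

open Literature.MathematicalPhysics.QuantumFieldTheory.Balaban1983to89
open Literature.MathematicalPhysics.QuantumFieldTheory.Balaban1983to89.B4Strip (ofRealVec Strip)
open Literature.MathematicalPhysics.QuantumFieldTheory.Balaban1983to89.B4StripCauchy (rOf rOf_pos)
open Literature.MathematicalPhysics.QuantumFieldTheory.Balaban1983to89.B4ContourShift
open Literature.MathematicalPhysics.QuantumFieldTheory.Balaban1983to89.B4TorusKernel (descendC periodConst summable_prod_pi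
  summable_of_decay norm_mFourierCoeff_descend_le exp_supNorm_le_prod summable_geometric_int supNorm_neg)
open Literature.MathematicalPhysics.QuantumFieldTheory.Balaban1983to89.B4TorusKernel.MultiPeriod (translate translate_apply torusKernel
  torusKernel_eq_periodise torusSupNorm torusKernel_translate centreVec supNorm_translate_centreVec translate_centreVec_centred
  torusSupNorm_of_centred)
open Literature.MathematicalPhysics.QuantumFieldTheory.Balaban1983to89.B5G183FreeDecay (freeMult MF MF_nonneg stripRegular_freeMult
  rOf_div_admissible rOf_div_pos)
open UnitAddTorus

variable {d : ℕ}

/-! ## §1 One dimension: the period-aware periodised exponential -/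

/-- the key integer inequality: for a centred representative `2|y| ≤ N` and `j ≠ 0`, `|y| + N(|j| − 1) ≤ |y + Nj|`
(each image beyond the first costs one full PERIOD; `B4TorusKernel.abs_add_mul_ge` has `|j| − 1` sites instead). [folklore] -/
theorem abs_add_mul_ge_period (y j : ℤ) {N : ℕ} (hy : 2 * |y| ≤ N) (hj : j ≠ 0) :
    (|y| : ℤ) + N * (|j| - 1) ≤ |y + N * j| := by
  have h1 : (N : ℤ) * |j| - |y| ≤ |y + N * j| := by
    have := abs_sub_abs_le_abs_sub ((N : ℤ) * j) (-y)
    rw [abs_mul, abs_neg, Nat.abs_cast] at this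
    have e : (N : ℤ) * j - -y = y + N * j := by ring
    rw [e] at this
    linarith
  have _ := Int.one_le_abs hj
  linarith

/-- the period-aware IMAGE WEIGHT: `1` for the representative itself (`j = 0`), `(e^{−κN})^{|j|−1}` for the `j`-th image. [folklore] -/
def imageWeight (κ : ℝ) (N : ℕ) (j : ℤ) : ℝ :=
  if j = 0 then 1 else Real.exp (-(κ * N)) ^ (j.natAbs - 1)

/-- `0 ≤ imageWeight`. [folklore] -/
theorem imageWeight_nonneg (κ : ℝ) (N : ℕ) (j : ℤ) : 0 ≤ imageWeight κ N j := by
  unfold imageWeight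
  split_ifs
  · exact zero_le_one
  · exact pow_nonneg (Real.exp_pos _).le _

/-- at `j = 0`. [folklore] -/
@[simp] theorem imageWeight_zero (κ : ℝ) (N : ℕ) : imageWeight κ N 0 = 1 := by simp [imageWeight]

/-- at `j = n + 1`, `n : ℕ`: `(e^{−κN})^n`. [folklore] -/
theorem imageWeight_natSucc (κ : ℝ) (N : ℕ) (n : ℕ) : imageWeight κ N ((n : ℤ) + 1) = Real.exp (-(κ * N)) ^ n := by
  have h : ((n : ℤ) + 1) ≠ 0 := by omega
  rw [imageWeight, if_neg h]
  congr 1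

/-- at `j = −(n + 1)`, `n : ℕ`: `(e^{−κN})^n`. [folklore] -/
theorem imageWeight_negSucc (κ : ℝ) (N : ℕ) (n : ℕ) : imageWeight κ N (-((n : ℤ) + 1)) = Real.exp (-(κ * N)) ^ n := by
  have h : (-((n : ℤ) + 1)) ≠ 0 := by omega
  rw [imageWeight, if_neg h]
  congr 1

/-- **THE PERIOD-AWARE PERIODISED EXPONENTIAL**: for `κ ≥ 0` and a centred representative `2|y| ≤ N`,
`e^{−κ|y + Nj|} ≤ e^{−κ|y|} · imageWeight κ N j` for every `j ∈ ℤ`. [folklore] -/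
theorem exp_translate_le_period {κ : ℝ} (hκ : 0 ≤ κ) (y j : ℤ) {N : ℕ} (hy : 2 * |y| ≤ N) :
    Real.exp (-(κ * |((y + N * j : ℤ) : ℝ)|)) ≤ Real.exp (-(κ * |(y : ℝ)|)) * imageWeight κ N j := by
  rcases eq_or_ne j 0 with rfl | hj
  · simp
  · rw [imageWeight, if_neg hj, ← Real.exp_nat_mul, ← Real.exp_add]
    apply Real.exp_le_exp.mpr
    have h := abs_add_mul_ge_period y j hy hj
    have hj1 : 1 ≤ j.natAbs := Int.natAbs_pos.mpr hj
    have e1 : (((j.natAbs - 1 : ℕ) : ℝ)) = (j.natAbs : ℝ) - 1 := by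
      rw [Nat.cast_sub hj1, Nat.cast_one]
    have e2 : ((j.natAbs : ℕ) : ℝ) = |(j : ℝ)| := by
      rw [← Int.cast_natCast (R := ℝ), Int.natCast_natAbs, Int.cast_abs]
    have h' : |(y : ℝ)| + (N : ℝ) * ((j.natAbs : ℝ) - 1) ≤ |((y + N * j : ℤ) : ℝ)| := by
      have hc := (Int.cast_le (R := ℝ)).mpr h
      push_cast at hc
      rw [← e2] at hc
      push_cast
      exact hc
    rw [e1]
    have := mul_le_mul_of_nonneg_left h' hκ
    nlinarith

/-- **THE TWO-SIDED IMAGE SUM**: for `κN > 0`, `Σ_{j ∈ ℤ} imageWeight κ N j = 1 + 2(1 − e^{−κN})⁻¹` (summable). [folklore] -/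
theorem tsum_imageWeight {κ : ℝ} {N : ℕ} (h : 0 < κ * N) :
    Summable (imageWeight κ N) ∧ ∑' j : ℤ, imageWeight κ N j = 1 + 2 * (1 - Real.exp (-(κ * N)))⁻¹ := by
  set r := Real.exp (-(κ * N)) with hr
  have hr0 : 0 ≤ r := (Real.exp_pos _).le
  have hr1 : r < 1 := Real.exp_lt_one_iff.mpr (by linarith)
  have hg := summable_geometric_of_lt_one hr0 hr1
  have hgeo : ∑' n : ℕ, r ^ n = (1 - r)⁻¹ := tsum_geometric_of_lt_one hr0 hr1
  set f : ℤ → ℝ := imageWeight κ N with hf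
  have hshift : (fun n : ℕ => f ((n : ℤ) + 1)) = fun n => r ^ n := by
    funext n; exact imageWeight_natSucc κ N n
  have hneg : (fun n : ℕ => f (-((n : ℤ) + 1))) = fun n => r ^ n := by
    funext n; exact imageWeight_negSucc κ N n
  have h1s : Summable (fun n : ℕ => f ((n : ℤ) + 1)) := by rw [hshift]; exact hg
  set g : ℕ → ℝ := fun n => f n with hg'
  have hg1 : (fun n : ℕ => g (n + 1)) = fun n : ℕ => f ((n : ℤ) + 1) := by
    funext n; simp only [hg', Nat.cast_succ]
  have h1 : Summable g := by
    have : Summable (fun n : ℕ => g (n + 1)) := by rw [hg1]; exact h1s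
    exact (summable_nat_add_iff 1).mp this
  have h3 : Summable (fun n : ℕ => f (-(n + 1 : ℤ))) := by rw [hneg]; exact hg
  have hs : Summable f := Summable.of_nat_of_neg_add_one h1 h3
  refine ⟨hs, ?_⟩
  rw [tsum_of_nat_of_neg_add_one (f := f) h1 h3, hneg, hgeo]
  have h0 : ∑' n : ℕ, f n = f 0 + ∑' n : ℕ, f ((n : ℤ) + 1) := by
    have := h1.tsum_eq_zero_add
    rw [hg1] at this
    simpa [hg'] using this
  rw [h0, hshift, hgeo]
  have : f 0 = 1 := imageWeight_zero κ N
  rw [this]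
  ring

/-! ## §2 The period-aware periodisation constant and the `MultiPeriod` twins -/

/-- **THE PERIOD-AWARE PERIODISATION CONSTANT**: `Π_i (1 + 2(1 − e^{−(κ/(d+1))·N_i})⁻¹)` — for the period vector `N_i = n·L_i` and the
fine-lattice rate `κ = κ₀/n` it equals `Π_i (1 + 2(1 − e^{−κ₀L_i/(d+1)})⁻¹)`, free of `n` (`periodConstU_div`). [folklore] -/
def periodConstU (κ : ℝ) (d : ℕ) (N : Fin (d + 1) → ℕ) : ℝ :=
  ∏ i, (1 + 2 * (1 - Real.exp (-(κ / (d + 1) * N i)))⁻¹)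

/-- each factor is `≥ 1`, so `1 ≤ periodConstU`. [folklore] -/
theorem one_le_periodConstU {κ : ℝ} (hκ : 0 < κ) {N : Fin (d + 1) → ℕ} (hN : ∀ i, 1 ≤ N i) : 1 ≤ periodConstU κ d N := by
  unfold periodConstU
  refine Finset.one_le_prod fun i _ => ?_
  have hpos : 0 < κ / (d + 1) * N i := mul_pos (div_pos hκ (by positivity)) (by exact_mod_cast hN i)
  have : Real.exp (-(κ / (d + 1) * N i)) < 1 := Real.exp_lt_one_iff.mpr (by linarith)
  have : 0 ≤ 2 * (1 - Real.exp (-(κ / (d + 1) * N i)))⁻¹ := by positivity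
  linarith

/-- `0 ≤ periodConstU`. [folklore] -/
theorem periodConstU_nonneg {κ : ℝ} (hκ : 0 < κ) {N : Fin (d + 1) → ℕ} (hN : ∀ i, 1 ≤ N i) : 0 ≤ periodConstU κ d N :=
  zero_le_one.trans (one_le_periodConstU hκ hN)

/-- SCALING: rate `κ/n` per fine site with periods `n·L_i` gives the constant of rate `κ` with periods `L_i` — the `n`-UNIFORMITY.
[folklore] -/
theorem periodConstU_div (n : ℕ) [NeZero n] (κ : ℝ) (Lc : Fin (d + 1) → ℕ) :
    periodConstU (κ / n) d (fun i => n * Lc i) = periodConstU κ d Lc := by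
  unfold periodConstU
  refine Finset.prod_congr rfl fun i _ => ?_
  have hn : (n : ℝ) ≠ 0 := by exact_mod_cast NeZero.ne n
  congr 4
  push_cast
  field_simp

/-- `2e^{t} + e^{−t} ≥ 3` for `t ≥ 0` (`e^{t} ≥ 1 + t`, `e^{−t} ≥ 1 − t`). [folklore] -/
theorem three_le_two_exp_add_exp_neg {t : ℝ} (ht : 0 ≤ t) : 3 ≤ 2 * Real.exp t + Real.exp (-t) := by
  have h1 := Real.add_one_le_exp t
  have h2 := Real.add_one_le_exp (-t)
  linarith

/-- **NEVER WEAKER THAN THE TREE's CONSTANT**: `periodConstU κ d N ≤ periodConst κ d` for `κ > 0`, all `N_i ≥ 1` (each factor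
`1 + 2/(1 − e^{−κ′N_i}) ≤ 1 + 2/(1 − e^{−κ′}) ≤ 2e^{κ′}/(1 − e^{−κ′})`). [folklore] -/
theorem periodConstU_le_periodConst {κ : ℝ} (hκ : 0 < κ) {N : Fin (d + 1) → ℕ} (hN : ∀ i, 1 ≤ N i) :
    periodConstU κ d N ≤ periodConst κ d := by
  unfold periodConstU periodConst
  set κ' := κ / (d + 1) with hκ'
  have eprod : (2 * Real.exp κ' / (1 - Real.exp (-κ'))) ^ (d + 1)
      = ∏ _i : Fin (d + 1), (2 * Real.exp κ' / (1 - Real.exp (-κ'))) := by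
    rw [Finset.prod_const, Finset.card_univ, Fintype.card_fin]
  rw [eprod]
  have hκ'pos : 0 < κ' := div_pos hκ (by positivity)
  have hq1 : Real.exp (-κ') < 1 := Real.exp_lt_one_iff.mpr (by linarith)
  have hq0 : 0 < Real.exp (-κ') := Real.exp_pos _
  refine Finset.prod_le_prod (fun i _ => ?_) (fun i _ => ?_)
  · have : Real.exp (-(κ' * N i)) < 1 :=
      Real.exp_lt_one_iff.mpr (by have := mul_pos hκ'pos (show (0:ℝ) < N i by exact_mod_cast hN i); linarith)
    have : 0 ≤ 2 * (1 - Real.exp (-(κ' * N i)))⁻¹ := by positivity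
    linarith
  · -- `1 + 2/(1 − e^{−κ′N_i}) ≤ 1 + 2/(1 − e^{−κ′}) ≤ 2e^{κ′}/(1 − e^{−κ′})`
    have hmono : Real.exp (-(κ' * N i)) ≤ Real.exp (-κ') := by
      apply Real.exp_le_exp.mpr
      have : (1 : ℝ) ≤ N i := by exact_mod_cast hN i
      nlinarith
    have hA : 1 + 2 * (1 - Real.exp (-(κ' * N i)))⁻¹ ≤ 1 + 2 * (1 - Real.exp (-κ'))⁻¹ := by
      have h1 : 0 < 1 - Real.exp (-κ') := by linarith
      have h2 : 1 - Real.exp (-κ') ≤ 1 - Real.exp (-(κ' * N i)) := by linarith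
      have := inv_anti₀ h1 h2
      linarith
    refine hA.trans ?_
    have h1 : 0 < 1 - Real.exp (-κ') := by linarith
    rw [div_eq_mul_inv, ← sub_nonneg]
    have key : 3 ≤ 2 * Real.exp κ' + Real.exp (-κ') := three_le_two_exp_add_exp_neg hκ'pos.le
    have e : 2 * Real.exp κ' * (1 - Real.exp (-κ'))⁻¹ - (1 + 2 * (1 - Real.exp (-κ'))⁻¹)
        = (2 * Real.exp κ' + Real.exp (-κ') - 3) * (1 - Real.exp (-κ'))⁻¹ := by
      field_simp
      ring
    rw [e]
    exact mul_nonneg (by linarith) (inv_nonneg.mpr h1.le)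

/-- TERMWISE MAJORANT, period-aware: for `2|x_i| ≤ N_i` and `‖K y‖ ≤ M e^{−κ|y|_∞}`,
`‖K(x + Nm)‖ ≤ M·e^{−κ′Σ_i|x_i|}·Π_i imageWeight κ′ N_i m_i`, `κ′ = κ/(d+1)` (no `e^{κ′(d+1)}` prefactor, full-period image steps).
[folklore] -/
theorem norm_translate_le_period (K : (Fin (d + 1) → ℤ) → ℂ) {κ M : ℝ} (hκ : 0 ≤ κ)
    (hK : ∀ y, ‖K y‖ ≤ M * Real.exp (-(κ * supNorm y))) {N : Fin (d + 1) → ℕ}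
    (x : Fin (d + 1) → ℤ) (hx : ∀ i, 2 * |x i| ≤ N i) (m : Fin (d + 1) → ℤ) :
    ‖K (translate N x m)‖ ≤
      M * Real.exp (-(κ / (d + 1) * ∑ i, |((x i : ℤ) : ℝ)|)) * ∏ i, imageWeight (κ / (d + 1)) (N i) (m i) := by
  have hM : 0 ≤ M := by
    have h := hK 0
    nlinarith [norm_nonneg (K 0), Real.exp_pos (-(κ * supNorm (0 : Fin (d + 1) → ℤ)))]
  set κ' := κ / (d + 1) with hκ'
  have hκ'0 : 0 ≤ κ' := div_nonneg hκ (by positivity)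
  have step : ∀ i, Real.exp (-(κ' * |((translate N x m i : ℤ) : ℝ)|))
      ≤ Real.exp (-(κ' * |((x i : ℤ) : ℝ)|)) * imageWeight κ' (N i) (m i) := by
    intro i
    have := exp_translate_le_period hκ'0 (x i) (m i) (hx i)
    simpa only [translate_apply] using this
  calc ‖K (translate N x m)‖ ≤ M * Real.exp (-(κ * supNorm (translate N x m))) := hK _
    _ ≤ M * ∏ i, Real.exp (-(κ' * |((translate N x m i : ℤ) : ℝ)|)) :=
        mul_le_mul_of_nonneg_left (exp_supNorm_le_prod hκ _) hM
    _ ≤ M * ∏ i, (Real.exp (-(κ' * |((x i : ℤ) : ℝ)|)) * imageWeight κ' (N i) (m i)) := by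
        apply mul_le_mul_of_nonneg_left _ hM
        exact Finset.prod_le_prod (fun i _ => (Real.exp_pos _).le) (fun i _ => step i)
    _ = M * Real.exp (-(κ' * ∑ i, |((x i : ℤ) : ℝ)|)) * ∏ i, imageWeight κ' (N i) (m i) := by
        rw [Finset.prod_mul_distrib, ← Real.exp_sum]
        have e : ∑ i, -(κ' * |((x i : ℤ) : ℝ)|) = -(κ' * ∑ i, |((x i : ℤ) : ℝ)|) := by
          rw [Finset.mul_sum, ← Finset.sum_neg_distrib]
        rw [e]
        ring

/-- **PERIOD-AWARE PERIODISATION BOUND**, unequal periods `N_i ≥ 1`, centred `x` (`2|x_i| ≤ N_i`), `κ > 0`: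
`Σ_m K(x + Nm)` converges absolutely and `‖Σ_m K(x + Nm)‖ ≤ M·periodConstU κ d N·e^{−(κ/(d+1))Σ_i|x_i|}`. [folklore] -/
theorem periodise_bound_period (K : (Fin (d + 1) → ℤ) → ℂ) {κ M : ℝ} (hκ : 0 < κ)
    (hK : ∀ y, ‖K y‖ ≤ M * Real.exp (-(κ * supNorm y))) {N : Fin (d + 1) → ℕ} (hN : ∀ i, 1 ≤ N i)
    (x : Fin (d + 1) → ℤ) (hx : ∀ i, 2 * |x i| ≤ N i) :
    Summable (fun m : Fin (d + 1) → ℤ => K (translate N x m)) ∧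
      ‖∑' m : Fin (d + 1) → ℤ, K (translate N x m)‖
        ≤ M * periodConstU κ d N * Real.exp (-(κ / (d + 1) * ∑ i, |((x i : ℤ) : ℝ)|)) := by
  set κ' := κ / (d + 1) with hκ'
  have hκ'pos : 0 < κ' := div_pos hκ (by positivity)
  have hki : ∀ i, 0 < κ' * (N i : ℕ) := fun i => mul_pos hκ'pos (by exact_mod_cast hN i)
  set A := M * Real.exp (-(κ' * ∑ i, |((x i : ℤ) : ℝ)|)) with hA
  obtain ⟨hps, hpe⟩ := summable_prod_pi (k := d + 1) (fun i j => imageWeight κ' (N i) j)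
    (fun i j => imageWeight_nonneg _ _ _) (fun i => (tsum_imageWeight (hki i)).1)
  have hle : ∀ m : Fin (d + 1) → ℤ, ‖K (translate N x m)‖ ≤ A * ∏ i, imageWeight κ' (N i) (m i) :=
    fun m => norm_translate_le_period K hκ.le hK x hx m
  have hmaj : Summable (fun m : Fin (d + 1) → ℤ => A * ∏ i, imageWeight κ' (N i) (m i)) := hps.mul_left A
  refine ⟨Summable.of_norm_bounded hmaj hle, ?_⟩
  have htsum : ∑' m : Fin (d + 1) → ℤ, ∏ i, imageWeight κ' (N i) (m i) = periodConstU κ d N := by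
    rw [hpe, periodConstU]
    exact Finset.prod_congr rfl fun i _ => (tsum_imageWeight (hki i)).2
  calc ‖∑' m : Fin (d + 1) → ℤ, K (translate N x m)‖
      ≤ ∑' m : Fin (d + 1) → ℤ, A * ∏ i, imageWeight κ' (N i) (m i) := tsum_of_norm_bounded hmaj.hasSum hle
    _ = A * periodConstU κ d N := by rw [tsum_mul_left, htsum]
    _ = M * periodConstU κ d N * Real.exp (-(κ / (d + 1) * ∑ i, |((x i : ℤ) : ℝ)|)) := by rw [hA]; ring

/-- the same in the sup norm: `‖Σ_m K(x + Nm)‖ ≤ M·periodConstU κ d N·e^{−(κ/(d+1))|x|_∞}`. [folklore] -/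
theorem periodise_bound_supNorm_period (K : (Fin (d + 1) → ℤ) → ℂ) {κ M : ℝ} (hκ : 0 < κ)
    (hK : ∀ y, ‖K y‖ ≤ M * Real.exp (-(κ * supNorm y))) {N : Fin (d + 1) → ℕ} (hN : ∀ i, 1 ≤ N i)
    (x : Fin (d + 1) → ℤ) (hx : ∀ i, 2 * |x i| ≤ N i) :
    ‖∑' m : Fin (d + 1) → ℤ, K (translate N x m)‖
      ≤ M * periodConstU κ d N * Real.exp (-(κ / (d + 1) * supNorm x)) := by
  refine le_trans (periodise_bound_period K hκ hK hN x hx).2 ?_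
  have hM : 0 ≤ M := by
    have h := hK 0
    nlinarith [norm_nonneg (K 0), Real.exp_pos (-(κ * supNorm (0 : Fin (d + 1) → ℤ)))]
  have hC : 0 ≤ periodConstU κ d N := periodConstU_nonneg hκ hN
  apply mul_le_mul_of_nonneg_left _ (mul_nonneg hM hC)
  apply Real.exp_le_exp.mpr
  obtain ⟨i, hi⟩ := exists_supNorm_eq x
  have : supNorm x ≤ ∑ j, |((x j : ℤ) : ℝ)| := by
    rw [hi, Int.cast_abs]
    exact Finset.single_le_sum (f := fun j => |((x j : ℤ) : ℝ)|) (fun j _ => abs_nonneg _) (Finset.mem_univ i)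
  have hκ' : 0 ≤ κ / (d + 1) := div_nonneg hκ.le (by positivity)
  nlinarith

/-! ## §3 The torus-kernel twins: centred representatives, descents, and the torus metric -/

/-- **PERIOD-AWARE UNIFORM DECAY OF THE TORUS KERNEL**, unequal periods: `‖ĉ(n)‖ ≤ M e^{−κ|n|_∞}`, `κ > 0`, all `N_i ≥ 1`,
`2|x_i| ≤ N_i` ⇒ `‖K_N(x)‖ ≤ M · periodConstU κ d N · e^{−(κ/(d+1))|x|_∞}`. [folklore] -/
theorem torusKernel_decay_period (f : C(UnitAddTorus (Fin (d + 1)), ℂ)) {κ M : ℝ} (hκ : 0 < κ)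
    (hdec : ∀ n, ‖mFourierCoeff f n‖ ≤ M * Real.exp (-(κ * supNorm n))) {N : Fin (d + 1) → ℕ} (hN : ∀ i, 1 ≤ N i)
    (x : Fin (d + 1) → ℤ) (hx : ∀ i, 2 * |x i| ≤ N i) :
    ‖torusKernel f N x‖ ≤ M * periodConstU κ d N * Real.exp (-(κ / (d + 1) * supNorm x)) := by
  have hs : Summable (mFourierCoeff f) := summable_of_decay _ hκ hdec
  rw [torusKernel_eq_periodise f hs hN x]
  have hx' : ∀ i, 2 * |(-x) i| ≤ (N i : ℤ) := fun i => by simpa using hx i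
  have h := periodise_bound_supNorm_period (mFourierCoeff f) hκ hdec hN (-x) hx'
  rwa [supNorm_neg] at h

/-- the same for the descent of a strip-regular multiplier `G` (`StripRegular G κ M`, `κ > 0`). [folklore] -/
theorem torusKernel_descend_decay_period {G : (Fin (d + 1) → ℂ) → ℂ} {κ M : ℝ} (h : StripRegular G κ M) (hκ : 0 < κ)
    {N : Fin (d + 1) → ℕ} (hN : ∀ i, 1 ≤ N i) (x : Fin (d + 1) → ℤ) (hx : ∀ i, 2 * |x i| ≤ N i) :
    ‖torusKernel (descendC G h hκ.le) N x‖ ≤ M * periodConstU κ d N * Real.exp (-(κ / (d + 1) * supNorm x)) :=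
  torusKernel_decay_period _ hκ (norm_mFourierCoeff_descend_le h hκ.le) hN x hx

/-- **PERIOD-AWARE UNIFORM DECAY IN THE TORUS METRIC, EVERY lattice point**: `‖K_N(x)‖ ≤ M · periodConstU κ d N · e^{−(κ/(d+1))·torusSupNorm N x}`
(periodicity + the centred statement at the centred representative). [folklore] -/
theorem torusKernel_decay_torusMetric_period (f : C(UnitAddTorus (Fin (d + 1)), ℂ)) {κ M : ℝ} (hκ : 0 < κ)
    (hdec : ∀ n, ‖mFourierCoeff f n‖ ≤ M * Real.exp (-(κ * supNorm n))) {N : Fin (d + 1) → ℕ} (hN : ∀ i, 1 ≤ N i)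
    (x : Fin (d + 1) → ℤ) :
    ‖torusKernel f N x‖ ≤ M * periodConstU κ d N * Real.exp (-(κ / (d + 1) * torusSupNorm N x)) := by
  rw [← torusKernel_translate f hN x (centreVec N x), ← supNorm_translate_centreVec hN x]
  exact torusKernel_decay_period f hκ hdec hN _ (translate_centreVec_centred hN x)

/-- the same for the descent of a strip-regular multiplier, EVERY lattice point. [folklore] -/
theorem torusKernel_descend_decay_torusMetric_period {G : (Fin (d + 1) → ℂ) → ℂ} {κ M : ℝ} (h : StripRegular G κ M)
    (hκ : 0 < κ) {N : Fin (d + 1) → ℕ} (hN : ∀ i, 1 ≤ N i) (x : Fin (d + 1) → ℤ) :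
    ‖torusKernel (descendC G h hκ.le) N x‖ ≤ M * periodConstU κ d N * Real.exp (-(κ / (d + 1) * torusSupNorm N x)) :=
  torusKernel_decay_torusMetric_period _ hκ (norm_mFourierCoeff_descend_le h hκ.le) hN x

/-! ## §4 The free fine-lattice kernel: n-UNIFORM torus decay (re-derivation of `B5G183FreeUniform` §5 with the per-coordinate constant) -/

section Free

/-- **PERIOD-AWARE DECAY OF THE TORUS KERNELS OF THE FREE PART** (any period vector `P_i ≥ 1`):
`‖torusKernel (descendC freeMult …) P m‖ ≤ MF N · periodConstU (r(d+1)/n) d P · e^{−((r(d+1)/n)/(d+1))·torusSupNorm P m}` —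
`B5G183FreeDecay.torusKernel_freeMult_decay` with `periodConst (r(d+1)/n) d` (∼ `n^{d+1}`) replaced by the period-aware constant. [folklore] -/
theorem torusKernel_freeMult_decay_period (n : ℕ) [NeZero n] (N : ℕ) {P : Fin (d + 1) → ℕ} (hP : ∀ i, 1 ≤ P i)
    (m : Fin (d + 1) → ℤ) :
    ‖torusKernel (descendC (fun q : Fin (d + 1) → ℂ => freeMult n N q)
        (stripRegular_freeMult n (rOf_div_pos n d).le (rOf_div_admissible n d) N)
        (rOf_div_pos n d).le) P m‖ ≤
      MF N * periodConstU (rOf (d + 1) / n) d P *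
        Real.exp (-((rOf (d + 1) / n) / (d + 1) * torusSupNorm P m)) :=
  torusKernel_descend_decay_torusMetric_period _ (rOf_div_pos n d) hP m

/-- **THE n-UNIFORM END — EXPONENTIAL DECAY OF THE FREE FINE-LATTICE KERNEL ON THE FINE TORUS `P_i = n·L_i`, UNIFORMLY IN THE
REFINEMENT `n`**: for every `n ≥ 1`, `N`, coarse periods `L_i ≥ 1` and every `m ∈ ℤ^{d+1}`,
`‖torusKernel (descendC freeMult …) (n·L) m‖ ≤ MF N · periodConstU (r(d+1)) d L · e^{−(r(d+1)/(n(d+1)))·torusSupNorm (n·L) m}` — the constant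
`MF N · Π_i (1 + 2/(1 − e^{−r(d+1)L_i/(d+1)}))` does not depend on `n`, and the exponent is `(r(d+1)/(d+1))` times the torus distance IN
COARSE UNITS (`torusSupNorm (n·L) m / n`).  PRIOR: `B5G183FreeUniform.torusKernel_freeMult_decay_uniform` (pv15-g12, 2026-08-19) — the module of
record for this statement; this is the image sum «performed in coarse units» that `B5G183FreeDecay` HONEST SCOPE (v) asked
for; only `n`-independence is content (constants crude).  U = 1, free part; nothing of Bałaban's carriers or of node NE3; NE2 NOT proved.
[folklore] -/
theorem torusKernel_freeMult_decay_uniform (n : ℕ) [NeZero n] (N : ℕ) {Lc : Fin (d + 1) → ℕ} (hLc : ∀ i, 1 ≤ Lc i)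
    (m : Fin (d + 1) → ℤ) :
    ‖torusKernel (descendC (fun q : Fin (d + 1) → ℂ => freeMult n N q)
        (stripRegular_freeMult n (rOf_div_pos n d).le (rOf_div_admissible n d) N)
        (rOf_div_pos n d).le) (fun i => n * Lc i) m‖ ≤
      MF N * periodConstU (rOf (d + 1)) d Lc *
        Real.exp (-((rOf (d + 1) / n) / (d + 1) * torusSupNorm (fun i => n * Lc i) m)) := by
  have hn : 1 ≤ n := Nat.one_le_iff_ne_zero.mpr (NeZero.ne n)
  have hP : ∀ i, 1 ≤ n * Lc i := fun i => Nat.one_le_iff_ne_zero.mpr (Nat.mul_ne_zero_iff.mpr ⟨by omega, by have := hLc i; omega⟩)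
  have h := torusKernel_freeMult_decay_period n N hP m
  rwa [periodConstU_div] at h

/-- the n-uniform constant is never larger than the tree's `periodConst` at the COARSE rate `r(d+1)` — i.e. the new bound at refinement `n`
is at least as good as `B5G183FreeDecay.torusKernel_freeMult_decay` was at `n = 1`. [folklore] -/
theorem periodConstU_free_le {Lc : Fin (d + 1) → ℕ} (hLc : ∀ i, 1 ≤ Lc i) :
    periodConstU (rOf (d + 1)) d Lc ≤ periodConst (rOf (d + 1)) d :=
  periodConstU_le_periodConst (rOf_pos _) hLc

end Free

end Summit.QuantumFields.BalabanUV.T4Continuum.TorusKernelUniformDecay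

end
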